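import Mathlib
import HarnessLib
import Summits.HubbardSuperconductivity.HubbardSuperconductivity.Theorems.KLProgrammeH10TwoPointLimitSectorMultiplierRates
import Summits.HubbardSuperconductivity.HubbardSuperconductivity.Theorems.KLProgrammeH10TwoPointLimitSectorMultiplierSteps

/-!
# Route `KLProgramme` — engine support, route (L2): the REAL-VARIABLE bookkeeping behind the uniform WEIGHTED torus bound of one sector function
# (order-three rates without cube roots, the packaging of the isotropic order-three and the tangential order-two pointwise constants, the
# moment constant `C_w' ≤ 1 + 12√2`)

Cell `gate-hubbard-kl`, seat p3 (g10); the order-three / weighted supplement of p4's `…H10TwoPointLimitSectorMultiplierRates` (whose factor lemmas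
`tfac_le`, `near_perp_le`, `near_tan_le`, `far_le`, `bracket_le`, `supp_le`, `sqrt_mul_sqrt_le` are reused with `κ ↦ κ²`), for W1 of the (E4)ₙ
supply of stmt-HubbardSuperconductivity-20437 (located risk «(b)-Wt@j≥1», cure W1-MIXED).  With `Λ = e₀4^{-n}`, `N = 2ⁿ`, `ΛN² = e₀`, `h = 2π/L`,
`U = h(N + ½)`:

* §1 rates WITHOUT cube roots: for `1 ≤ √K`, `c ≤ √K`, the pointwise bounds `c·h³/Λ³`, `c·U³/Λ³`, `c_T|2π/β|³/Λ³`, `κ₂h²/Λ²` are below the master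
  lemma's currency `1·(4/(sQ))^m` at the rates `s₁ = s₃ = 2Λ/(π√K)`, `s₂ = s₃' = 4Λ/(LU√K)`, `s₀ = 2Λβ/(Pπ√c_G)`
  (`cu_rate_space_le`, `cu_rate_perp_le`, `cu_rate_time_le`, `sq_rate_space_le`);
* §2 `iso3_pack_le` — the isotropic order-three constant of `norm_fwdDiff_three_space_klAniso_le` is `≤ κ₃·W³/Λ³`,
  `κ₃ = (8g₃+12g₂)G₁³ + (12g₂+6g₁)G₁K₂e₀ + 2g₁(4e₀²+8a₃) + 108B((4g₂+2g₁)G₁²e₀ + 2g₁K₂e₀²) + 1296g₁G₁Be₀² + 1296Be₀³`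
  (`‖w‖ ≤ W`, `‖w₁+iw₂‖ ≤ 2W`, `1 + 6/w_n ≤ 3N`, `ΛN ≤ e₀`, `Λ ≤ e₀`, `A₃Λ² ≤ a₃`);
  `tan2_pack_le` — the tangential order-two constant of `norm_fwdDiff_two_space_klAniso_le` is `≤ κ₂·h²/Λ²`,
  `κ₂ = (4g₂+2g₁)Y₃² + (9/2)g₁K₂e₀ + 216g₁BY₃e₀ + 486Be₀²`, `Y₃ = G₁ + (3/2)K₂ρ̄ + (9/2)K₂` (`τ₀ = hG₁`, `ρ ≤ ρ̄/N`, `‖w‖ ≤ (3/2)hN`,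
  `‖w₁+iw₂‖ ≤ 3hN`, `hN² ≤ 1`, `ΛN² = e₀`);
* §3 `one_add_six_div_sectorWidth_le` (`1 + 6/w_n ≤ 3·2ⁿ`), `cw_ratio_le` (`2√2·s₁/(s₂V) ≤ 6√2`), `bracketWt_le`
  (`C²·(n₂n₃) + fr/16 ≤ (C₀²/4 + 1/16)(4n₂n₃ + fr)`).

Pure real analysis; no model objects; everything proved. [folklore]
-/

noncomputable section

namespace Summit.HubbardSuperconductivity.HubbardSuperconductivity.Theorems.TorusFourierL2

set_option linter.dupNamespace false -- summit = problem name (single-conjunct summit), D-0017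

open Literature.MathematicalPhysics.QuantumLattice Literature.MathematicalPhysics.QuantumLattice.BandSectorCounting
open scoped Real

/-! ### §1 Rates without cube roots -/

/-- **Space rate along a step of length `h = 2π/L` at order three**: if `1 ≤ √K` and `c ≤ √K` then `c·h³/Λ³ ≤ 1·(4/(s₁L))³` for
`s₁ = 2Λ/(π√K)` (`(4/(s₁L))³ = (√K)³h³/Λ³ ≥ √K·h³/Λ³`). [folklore] -/
theorem cu_rate_space_le {K c Λ L : ℝ} (hK1 : 1 ≤ Real.sqrt K) (hc : c ≤ Real.sqrt K) (hΛ : 0 < Λ) (hL : 0 < L) :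
    c * (2 * π / L) ^ 3 / Λ ^ 3 ≤ 1 * (4 / (2 * Λ / (π * Real.sqrt K) * L)) ^ 3 := by
  have hπ := Real.pi_pos
  have hs : 0 < Real.sqrt K := lt_of_lt_of_le one_pos hK1
  have e : 4 / (2 * Λ / (π * Real.sqrt K) * L) = Real.sqrt K * ((2 * π / L) / Λ) := by field_simp; ring
  rw [e, one_mul, mul_pow]
  have h3 : c ≤ Real.sqrt K ^ 3 := hc.trans (by
    have h2 : 1 ≤ Real.sqrt K ^ 2 := by nlinarith
    calc Real.sqrt K = Real.sqrt K * 1 := (mul_one _).symm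
      _ ≤ Real.sqrt K * Real.sqrt K ^ 2 := mul_le_mul_of_nonneg_left h2 hs.le
      _ = Real.sqrt K ^ 3 := by ring)
  have h0 : 0 ≤ ((2 * π / L) / Λ) ^ 3 := by positivity
  calc c * (2 * π / L) ^ 3 / Λ ^ 3 = c * ((2 * π / L) / Λ) ^ 3 := by rw [div_pow]; ring
    _ ≤ Real.sqrt K ^ 3 * ((2 * π / L) / Λ) ^ 3 := mul_le_mul_of_nonneg_right h3 h0

/-- **Space rate along the long steps (`v⊥`, `v`) at order three** (scale `U`): if `1 ≤ √K` and `c ≤ √K` then `c·U³/Λ³ ≤ 1·(4/(s₂L))³`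
for `s₂ = 4Λ/(LU√K)`. [folklore] -/
theorem cu_rate_perp_le {K c Λ L U : ℝ} (hK1 : 1 ≤ Real.sqrt K) (hc : c ≤ Real.sqrt K) (hΛ : 0 < Λ) (hL : 0 < L) (hU : 0 < U) :
    c * U ^ 3 / Λ ^ 3 ≤ 1 * (4 / (4 * Λ / (L * U * Real.sqrt K) * L)) ^ 3 := by
  have hs : 0 < Real.sqrt K := lt_of_lt_of_le one_pos hK1
  have e : 4 / (4 * Λ / (L * U * Real.sqrt K) * L) = Real.sqrt K * (U / Λ) := by field_simp
  rw [e, one_mul, mul_pow]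
  have h3 : c ≤ Real.sqrt K ^ 3 := hc.trans (by
    have h2 : 1 ≤ Real.sqrt K ^ 2 := by nlinarith
    calc Real.sqrt K = Real.sqrt K * 1 := (mul_one _).symm
      _ ≤ Real.sqrt K * Real.sqrt K ^ 2 := mul_le_mul_of_nonneg_left h2 hs.le
      _ = Real.sqrt K ^ 3 := by ring)
  have h0 : 0 ≤ (U / Λ) ^ 3 := by positivity
  calc c * U ^ 3 / Λ ^ 3 = c * (U / Λ) ^ 3 := by rw [div_pow]; ring
    _ ≤ Real.sqrt K ^ 3 * (U / Λ) ^ 3 := mul_le_mul_of_nonneg_right h3 h0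

/-- **Time rate at order three**: if `1 ≤ √c_G` and `c_T ≤ √c_G` then `c_T|2π/β|³·1/Λ³ ≤ 1·(4/(s₀P))³` for `s₀ = 2Λβ/(Pπ√c_G)`. [folklore] -/
theorem cu_rate_time_le {cG cT Λ β P : ℝ} (hK1 : 1 ≤ Real.sqrt cG) (hc : cT ≤ Real.sqrt cG) (hΛ : 0 < Λ) (hβ : 0 < β) (hP : 0 < P) :
    cT * |2 * π / β| ^ 3 * 1 / Λ ^ 3 ≤ 1 * (4 / (2 * Λ * β / (P * π * Real.sqrt cG) * P)) ^ 3 := by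
  have hπ := Real.pi_pos
  have hs : 0 < Real.sqrt cG := lt_of_lt_of_le one_pos hK1
  have e : 4 / (2 * Λ * β / (P * π * Real.sqrt cG) * P) = Real.sqrt cG * ((2 * π / β) / Λ) := by field_simp; ring
  rw [e, one_mul, mul_pow, abs_of_pos (by positivity : 0 < 2 * π / β)]
  have h3 : cT ≤ Real.sqrt cG ^ 3 := hc.trans (by
    have h2 : 1 ≤ Real.sqrt cG ^ 2 := by nlinarith
    calc Real.sqrt cG = Real.sqrt cG * 1 := (mul_one _).symm
      _ ≤ Real.sqrt cG * Real.sqrt cG ^ 2 := mul_le_mul_of_nonneg_left h2 hs.le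
      _ = Real.sqrt cG ^ 3 := by ring)
  have h0 : 0 ≤ ((2 * π / β) / Λ) ^ 3 := by positivity
  calc cT * (2 * π / β) ^ 3 * 1 / Λ ^ 3 = cT * ((2 * π / β) / Λ) ^ 3 := by rw [div_pow]; ring
    _ ≤ Real.sqrt cG ^ 3 * ((2 * π / β) / Λ) ^ 3 := mul_le_mul_of_nonneg_right h3 h0

/-- **Space rate along the tangent step at order two**: if `κ₂ ≤ K` then `h²κ₂/Λ² ≤ 1·(4/(s₁L))²` for `s₁ = 2Λ/(π√K)`. [folklore] -/
theorem sq_rate_space_le {K κ₂ Λ L : ℝ} (hK : 0 < K) (hκ₂ : κ₂ ≤ K) (hΛ : 0 < Λ) (hL : 0 < L) :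
    (2 * π / L) ^ 2 * κ₂ / Λ ^ 2 ≤ 1 * (4 / (2 * Λ / (π * Real.sqrt K) * L)) ^ 2 := by
  rw [rate_space_sq hK hΛ hL]
  have h0 : 0 ≤ (2 * π / L) ^ 2 / Λ ^ 2 := by positivity
  calc (2 * π / L) ^ 2 * κ₂ / Λ ^ 2 = κ₂ * ((2 * π / L) ^ 2 / Λ ^ 2) := by ring
    _ ≤ K * ((2 * π / L) ^ 2 / Λ ^ 2) := mul_le_mul_of_nonneg_right hκ₂ h0
    _ = (2 * π / L) ^ 2 * K / Λ ^ 2 := by ring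

/-! ### §2 Packaging of the pointwise constants -/

/-- **The isotropic order-three constant packaged as `κ₃·W³/Λ³`.**  In the shape produced by `norm_fwdDiff_three_space_klAniso_le` (`τ = G₁·Wn`,
`K₃ = 4 + 8A₃`, angular argument `Dn·Wm`): if `0 ≤ Wn ≤ W`, `0 ≤ Wm ≤ 2W`, `0 ≤ Dn ≤ 3N`, `Λ ≤ e₀`, `ΛN ≤ e₀`, `A₃Λ² ≤ a₃` then the constant is
`≤ κ₃·W³/Λ³`. [folklore] -/
theorem iso3_pack_le {g₁ g₂ g₃ G₁ K₂ A₃ a₃ B Λ N e₀ W Wn Wm Dn : ℝ} (hg₁ : 0 ≤ g₁) (hg₂ : 0 ≤ g₂) (hg₃ : 0 ≤ g₃) (hG₁ : 0 ≤ G₁)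
    (hK₂ : 0 ≤ K₂) (hA₃ : 0 ≤ A₃) (hB : 0 ≤ B) (hΛ : 0 < Λ) (hN : 0 ≤ N) (hW : 0 ≤ W) (hWn0 : 0 ≤ Wn) (hWn : Wn ≤ W) (hWm0 : 0 ≤ Wm)
    (hWm : Wm ≤ 2 * W) (hDn0 : 0 ≤ Dn) (hDn : Dn ≤ 3 * N) (hΛe : Λ ≤ e₀) (hΛN : Λ * N ≤ e₀) (ha₃ : A₃ * Λ ^ 2 ≤ a₃) :
    ((8 * g₃ + 12 * g₂) * (G₁ * Wn) ^ 3 / Λ ^ 3 + (12 * g₂ + 6 * g₁) * ((G₁ * Wn) * (K₂ * Wn ^ 2)) / Λ ^ 2 +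
          2 * g₁ * ((4 + 8 * A₃) * Wn ^ 3) / Λ) * 1 +
        3 * (((4 * g₂ + 2 * g₁) * (G₁ * Wn) ^ 2 / Λ ^ 2 + 2 * g₁ * (K₂ * Wn ^ 2) / Λ) * (6 * B * (Dn * Wm))) +
        3 * (2 * g₁ * (G₁ * Wn) / Λ * (6 * B * (Dn * Wm) ^ 2)) + 1 * (6 * B * (Dn * Wm) ^ 3) ≤
      ((8 * g₃ + 12 * g₂) * G₁ ^ 3 + (12 * g₂ + 6 * g₁) * G₁ * K₂ * e₀ + 2 * g₁ * (4 * e₀ ^ 2 + 8 * a₃) +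
          108 * B * ((4 * g₂ + 2 * g₁) * G₁ ^ 2 * e₀ + 2 * g₁ * K₂ * e₀ ^ 2) + 1296 * g₁ * G₁ * B * e₀ ^ 2 + 1296 * B * e₀ ^ 3) *
        W ^ 3 / Λ ^ 3 := by
  have he : 0 ≤ e₀ := hΛ.le.trans hΛe
  have hW3 : Wn ^ 3 ≤ W ^ 3 := pow_le_pow_left₀ hWn0 hWn 3
  have hW2 : Wn ^ 2 ≤ W ^ 2 := pow_le_pow_left₀ hWn0 hWn 2
  have hDW : Dn * Wm ≤ 3 * N * (2 * W) := mul_le_mul hDn hWm hWm0 (by positivity)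
  have hDW0 : 0 ≤ Dn * Wm := mul_nonneg hDn0 hWm0
  have hΛ3 : 0 < Λ ^ 3 := pow_pos hΛ 3
  -- term 1
  have t1 : (8 * g₃ + 12 * g₂) * (G₁ * Wn) ^ 3 / Λ ^ 3 ≤ (8 * g₃ + 12 * g₂) * G₁ ^ 3 * (W ^ 3 / Λ ^ 3) := by
    rw [mul_pow, mul_div_assoc, mul_assoc, mul_div_assoc]
    refine mul_le_mul_of_nonneg_left ?_ (by positivity)
    exact mul_le_mul_of_nonneg_left (div_le_div_of_nonneg_right hW3 hΛ3.le) (by positivity)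
  -- term 2: `(G₁Wn)(K₂Wn²)/Λ² = G₁K₂Wn³Λ/Λ³ ≤ G₁K₂e₀W³/Λ³`
  have t2 : (12 * g₂ + 6 * g₁) * ((G₁ * Wn) * (K₂ * Wn ^ 2)) / Λ ^ 2 ≤ (12 * g₂ + 6 * g₁) * G₁ * K₂ * e₀ * (W ^ 3 / Λ ^ 3) := by
    have e : (12 * g₂ + 6 * g₁) * ((G₁ * Wn) * (K₂ * Wn ^ 2)) / Λ ^ 2 = (12 * g₂ + 6 * g₁) * G₁ * K₂ * Λ * (Wn ^ 3 / Λ ^ 3) := by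
      field_simp
    rw [e]
    have h1 : (12 * g₂ + 6 * g₁) * G₁ * K₂ * Λ ≤ (12 * g₂ + 6 * g₁) * G₁ * K₂ * e₀ := mul_le_mul_of_nonneg_left hΛe (by positivity)
    exact mul_le_mul h1 (div_le_div_of_nonneg_right hW3 hΛ3.le) (by positivity) (by positivity)
  -- term 3: `2g₁(4+8A₃)Wn³/Λ = 2g₁(4Λ²+8A₃Λ²)Wn³/Λ³ ≤ 2g₁(4e₀²+8a₃)W³/Λ³`
  have t3 : 2 * g₁ * ((4 + 8 * A₃) * Wn ^ 3) / Λ ≤ 2 * g₁ * (4 * e₀ ^ 2 + 8 * a₃) * (W ^ 3 / Λ ^ 3) := by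
    have e : 2 * g₁ * ((4 + 8 * A₃) * Wn ^ 3) / Λ = 2 * g₁ * (4 * Λ ^ 2 + 8 * (A₃ * Λ ^ 2)) * (Wn ^ 3 / Λ ^ 3) := by
      field_simp
    rw [e]
    have hΛ2 : Λ ^ 2 ≤ e₀ ^ 2 := pow_le_pow_left₀ hΛ.le hΛe 2
    have h1 : 2 * g₁ * (4 * Λ ^ 2 + 8 * (A₃ * Λ ^ 2)) ≤ 2 * g₁ * (4 * e₀ ^ 2 + 8 * a₃) :=
      mul_le_mul_of_nonneg_left (by linarith) (by positivity)
    have h0 : 0 ≤ 2 * g₁ * (4 * e₀ ^ 2 + 8 * a₃) := le_trans (by positivity) h1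
    exact mul_le_mul h1 (div_le_div_of_nonneg_right hW3 hΛ3.le) (by positivity) h0
  -- term 4: `3[(4g₂+2g₁)G₁²Wn²/Λ² + 2g₁K₂Wn²/Λ]·6B·DnWm ≤ 108B[(4g₂+2g₁)G₁²e₀ + 2g₁K₂e₀²]W³/Λ³`
  have t4 : 3 * (((4 * g₂ + 2 * g₁) * (G₁ * Wn) ^ 2 / Λ ^ 2 + 2 * g₁ * (K₂ * Wn ^ 2) / Λ) * (6 * B * (Dn * Wm))) ≤
      108 * B * ((4 * g₂ + 2 * g₁) * G₁ ^ 2 * e₀ + 2 * g₁ * K₂ * e₀ ^ 2) * (W ^ 3 / Λ ^ 3) := by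
    have hbr : (4 * g₂ + 2 * g₁) * (G₁ * Wn) ^ 2 / Λ ^ 2 + 2 * g₁ * (K₂ * Wn ^ 2) / Λ ≤
        ((4 * g₂ + 2 * g₁) * G₁ ^ 2 * Λ + 2 * g₁ * K₂ * Λ ^ 2) * (W ^ 2 / Λ ^ 3) := by
      have e : (4 * g₂ + 2 * g₁) * (G₁ * Wn) ^ 2 / Λ ^ 2 + 2 * g₁ * (K₂ * Wn ^ 2) / Λ =
          ((4 * g₂ + 2 * g₁) * G₁ ^ 2 * Λ + 2 * g₁ * K₂ * Λ ^ 2) * (Wn ^ 2 / Λ ^ 3) := by field_simp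
      rw [e]
      exact mul_le_mul_of_nonneg_left (div_le_div_of_nonneg_right hW2 hΛ3.le) (by positivity)
    have hbr0 : 0 ≤ (4 * g₂ + 2 * g₁) * (G₁ * Wn) ^ 2 / Λ ^ 2 + 2 * g₁ * (K₂ * Wn ^ 2) / Λ := by positivity
    calc 3 * (((4 * g₂ + 2 * g₁) * (G₁ * Wn) ^ 2 / Λ ^ 2 + 2 * g₁ * (K₂ * Wn ^ 2) / Λ) * (6 * B * (Dn * Wm)))
        ≤ 3 * ((((4 * g₂ + 2 * g₁) * G₁ ^ 2 * Λ + 2 * g₁ * K₂ * Λ ^ 2) * (W ^ 2 / Λ ^ 3)) * (6 * B * (3 * N * (2 * W)))) := by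
          gcongr
      _ = 108 * B * (((4 * g₂ + 2 * g₁) * G₁ ^ 2 * (Λ * N) + 2 * g₁ * K₂ * (Λ * (Λ * N)))) * (W ^ 3 / Λ ^ 3) := by ring
      _ ≤ 108 * B * ((4 * g₂ + 2 * g₁) * G₁ ^ 2 * e₀ + 2 * g₁ * K₂ * (e₀ * e₀)) * (W ^ 3 / Λ ^ 3) := by
          have hΛN0 : 0 ≤ Λ * N := by positivity
          gcongr
      _ = _ := by ring
  -- term 5: `3·(2g₁G₁Wn/Λ)·6B(DnWm)² ≤ 1296 g₁G₁B e₀² W³/Λ³`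
  have t5 : 3 * (2 * g₁ * (G₁ * Wn) / Λ * (6 * B * (Dn * Wm) ^ 2)) ≤ 1296 * g₁ * G₁ * B * e₀ ^ 2 * (W ^ 3 / Λ ^ 3) := by
    have hsq : (Dn * Wm) ^ 2 ≤ (3 * N * (2 * W)) ^ 2 := pow_le_pow_left₀ hDW0 hDW 2
    calc 3 * (2 * g₁ * (G₁ * Wn) / Λ * (6 * B * (Dn * Wm) ^ 2))
        ≤ 3 * (2 * g₁ * (G₁ * W) / Λ * (6 * B * (3 * N * (2 * W)) ^ 2)) := by gcongr
      _ = 1296 * g₁ * G₁ * B * (Λ * N) ^ 2 * (W ^ 3 / Λ ^ 3) := by field_simp; ring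
      _ ≤ 1296 * g₁ * G₁ * B * e₀ ^ 2 * (W ^ 3 / Λ ^ 3) := by
          have : (Λ * N) ^ 2 ≤ e₀ ^ 2 := pow_le_pow_left₀ (by positivity) hΛN 2
          gcongr
  -- term 6: `6B(DnWm)³ ≤ 1296 B e₀³ W³/Λ³`
  have t6 : 1 * (6 * B * (Dn * Wm) ^ 3) ≤ 1296 * B * e₀ ^ 3 * (W ^ 3 / Λ ^ 3) := by
    have hcu : (Dn * Wm) ^ 3 ≤ (3 * N * (2 * W)) ^ 3 := pow_le_pow_left₀ hDW0 hDW 3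
    calc 1 * (6 * B * (Dn * Wm) ^ 3) ≤ 1 * (6 * B * (3 * N * (2 * W)) ^ 3) := by gcongr
      _ = 1296 * B * (Λ * N) ^ 3 * (W ^ 3 / Λ ^ 3) := by field_simp; ring
      _ ≤ 1296 * B * e₀ ^ 3 * (W ^ 3 / Λ ^ 3) := by
          have : (Λ * N) ^ 3 ≤ e₀ ^ 3 := pow_le_pow_left₀ (by positivity) hΛN 3
          gcongr
  have etot : ((8 * g₃ + 12 * g₂) * G₁ ^ 3 + (12 * g₂ + 6 * g₁) * G₁ * K₂ * e₀ + 2 * g₁ * (4 * e₀ ^ 2 + 8 * a₃) +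
          108 * B * ((4 * g₂ + 2 * g₁) * G₁ ^ 2 * e₀ + 2 * g₁ * K₂ * e₀ ^ 2) + 1296 * g₁ * G₁ * B * e₀ ^ 2 + 1296 * B * e₀ ^ 3) *
        W ^ 3 / Λ ^ 3 =
      (8 * g₃ + 12 * g₂) * G₁ ^ 3 * (W ^ 3 / Λ ^ 3) + (12 * g₂ + 6 * g₁) * G₁ * K₂ * e₀ * (W ^ 3 / Λ ^ 3) +
        2 * g₁ * (4 * e₀ ^ 2 + 8 * a₃) * (W ^ 3 / Λ ^ 3) +
        108 * B * ((4 * g₂ + 2 * g₁) * G₁ ^ 2 * e₀ + 2 * g₁ * K₂ * e₀ ^ 2) * (W ^ 3 / Λ ^ 3) +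
        1296 * g₁ * G₁ * B * e₀ ^ 2 * (W ^ 3 / Λ ^ 3) + 1296 * B * e₀ ^ 3 * (W ^ 3 / Λ ^ 3) := by ring
  rw [etot, mul_one]
  linarith [t1, t2, t3, t4, t5, t6]

/-- **The tangential order-two constant packaged as `κ₂·h²/Λ²`.**  In the shape produced by `norm_fwdDiff_two_space_klAniso_le` (`τ₀ = hG₁`,
`τ₂ = τ₀ + K₂(ρ + 2Wn)Wn`, angular argument `Dn·Wm`): if `0 ≤ ρ ≤ ρ̄/N`, `0 ≤ Wn ≤ (3/2)hN`, `0 ≤ Wm ≤ 3hN`, `0 ≤ Dn ≤ 3N`, `hN² ≤ 1`, `1 ≤ N`,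
`ΛN² = e₀` then the constant is `≤ κ₂·h²/Λ²`. [folklore] -/
theorem tan2_pack_le {g₁ g₂ G₁ K₂ B Λ N e₀ h ρ ρb Wn Wm Dn : ℝ} (hg₁ : 0 ≤ g₁) (hg₂ : 0 ≤ g₂) (hG₁ : 0 ≤ G₁) (hK₂ : 0 ≤ K₂)
    (hB : 0 ≤ B) (hΛ : 0 < Λ) (hN : 1 ≤ N) (hh : 0 < h) (hρ0 : 0 ≤ ρ) (hρ : ρ ≤ ρb / N) (hρb : 0 ≤ ρb) (hWn0 : 0 ≤ Wn)
    (hWn : Wn ≤ 3 / 2 * (h * N)) (hWm0 : 0 ≤ Wm) (hWm : Wm ≤ 3 * (h * N)) (hDn0 : 0 ≤ Dn) (hDn : Dn ≤ 3 * N) (hhN : h * N ^ 2 ≤ 1)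
    (hΛN2 : Λ * N ^ 2 = e₀) :
    ((4 * g₂ + 2 * g₁) * (h * G₁ + K₂ * (ρ + 2 * Wn) * Wn) ^ 2 / Λ ^ 2 + 2 * g₁ * (K₂ * Wn ^ 2) / Λ) * 1 +
        4 * g₁ * (h * G₁ + K₂ * (ρ + 2 * Wn) * Wn) / Λ * (6 * B * (Dn * Wm)) + 1 * (6 * B * (Dn * Wm) ^ 2) ≤
      ((4 * g₂ + 2 * g₁) * (G₁ + 3 / 2 * K₂ * ρb + 9 / 2 * K₂) ^ 2 + 9 / 2 * g₁ * K₂ * e₀ +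
          216 * g₁ * B * (G₁ + 3 / 2 * K₂ * ρb + 9 / 2 * K₂) * e₀ + 486 * B * e₀ ^ 2) * h ^ 2 / Λ ^ 2 := by
  have hN0 : 0 < N := lt_of_lt_of_le one_pos hN
  have he : 0 ≤ e₀ := by rw [← hΛN2]; positivity
  set Y : ℝ := G₁ + 3 / 2 * K₂ * ρb + 9 / 2 * K₂ with hY
  have hY0 : 0 ≤ Y := by rw [hY]; positivity
  -- `τ₂ ≤ hY`
  have hτ : h * G₁ + K₂ * (ρ + 2 * Wn) * Wn ≤ h * Y := by
    have h1 : (ρ + 2 * Wn) * Wn ≤ (ρb / N + 3 * (h * N)) * (3 / 2 * (h * N)) :=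
      mul_le_mul (add_le_add hρ (by linarith)) hWn hWn0 (by positivity)
    have h2 : (ρb / N + 3 * (h * N)) * (3 / 2 * (h * N)) = h * (3 / 2 * ρb + 9 / 2 * (h * N ^ 2)) := by
      field_simp
      ring
    have h3 : 3 / 2 * ρb + 9 / 2 * (h * N ^ 2) ≤ 3 / 2 * ρb + 9 / 2 := by linarith
    have h4 : K₂ * ((ρ + 2 * Wn) * Wn) ≤ K₂ * (h * (3 / 2 * ρb + 9 / 2)) := by
      refine mul_le_mul_of_nonneg_left ?_ hK₂
      rw [h2] at h1
      exact h1.trans (mul_le_mul_of_nonneg_left h3 hh.le)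
    rw [hY]
    nlinarith [h4]
  have hτ0 : 0 ≤ h * G₁ + K₂ * (ρ + 2 * Wn) * Wn := by positivity
  have hDW : Dn * Wm ≤ 3 * N * (3 * (h * N)) := mul_le_mul hDn hWm hWm0 (by positivity)
  have hDW0 : 0 ≤ Dn * Wm := mul_nonneg hDn0 hWm0
  have hΛ2 : 0 < Λ ^ 2 := pow_pos hΛ 2
  -- term 1
  have t1 : (4 * g₂ + 2 * g₁) * (h * G₁ + K₂ * (ρ + 2 * Wn) * Wn) ^ 2 / Λ ^ 2 ≤ (4 * g₂ + 2 * g₁) * Y ^ 2 * (h ^ 2 / Λ ^ 2) := by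
    have hsq : (h * G₁ + K₂ * (ρ + 2 * Wn) * Wn) ^ 2 ≤ (h * Y) ^ 2 := pow_le_pow_left₀ hτ0 hτ 2
    calc (4 * g₂ + 2 * g₁) * (h * G₁ + K₂ * (ρ + 2 * Wn) * Wn) ^ 2 / Λ ^ 2 ≤ (4 * g₂ + 2 * g₁) * (h * Y) ^ 2 / Λ ^ 2 := by
          gcongr
      _ = (4 * g₂ + 2 * g₁) * Y ^ 2 * (h ^ 2 / Λ ^ 2) := by ring
  -- term 2: `2g₁K₂Wn²/Λ ≤ 2g₁K₂(9/4)h²N²/Λ = (9/2)g₁K₂e₀h²/Λ²`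
  have t2 : 2 * g₁ * (K₂ * Wn ^ 2) / Λ ≤ 9 / 2 * g₁ * K₂ * e₀ * (h ^ 2 / Λ ^ 2) := by
    have hsq : Wn ^ 2 ≤ (3 / 2 * (h * N)) ^ 2 := pow_le_pow_left₀ hWn0 hWn 2
    calc 2 * g₁ * (K₂ * Wn ^ 2) / Λ ≤ 2 * g₁ * (K₂ * (3 / 2 * (h * N)) ^ 2) / Λ := by gcongr
      _ = 9 / 2 * g₁ * K₂ * (Λ * N ^ 2) * (h ^ 2 / Λ ^ 2) := by field_simp; ring
      _ = 9 / 2 * g₁ * K₂ * e₀ * (h ^ 2 / Λ ^ 2) := by rw [hΛN2]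
  -- term 3: `4g₁τ₂/Λ·6B·DnWm ≤ 4g₁hY·6B·9hN²/Λ = 216g₁BYe₀h²/Λ²`
  have t3 : 4 * g₁ * (h * G₁ + K₂ * (ρ + 2 * Wn) * Wn) / Λ * (6 * B * (Dn * Wm)) ≤ 216 * g₁ * B * Y * e₀ * (h ^ 2 / Λ ^ 2) := by
    calc 4 * g₁ * (h * G₁ + K₂ * (ρ + 2 * Wn) * Wn) / Λ * (6 * B * (Dn * Wm))
        ≤ 4 * g₁ * (h * Y) / Λ * (6 * B * (3 * N * (3 * (h * N)))) := by gcongr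
      _ = 216 * g₁ * B * Y * (Λ * N ^ 2) * (h ^ 2 / Λ ^ 2) := by field_simp; ring
      _ = 216 * g₁ * B * Y * e₀ * (h ^ 2 / Λ ^ 2) := by rw [hΛN2]
  -- term 4: `6B(DnWm)² ≤ 6B·81h²N⁴ = 486Be₀²h²/Λ²`
  have t4 : 1 * (6 * B * (Dn * Wm) ^ 2) ≤ 486 * B * e₀ ^ 2 * (h ^ 2 / Λ ^ 2) := by
    have hsq : (Dn * Wm) ^ 2 ≤ (3 * N * (3 * (h * N))) ^ 2 := pow_le_pow_left₀ hDW0 hDW 2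
    calc 1 * (6 * B * (Dn * Wm) ^ 2) ≤ 1 * (6 * B * (3 * N * (3 * (h * N))) ^ 2) := by gcongr
      _ = 486 * B * (Λ * N ^ 2) ^ 2 * (h ^ 2 / Λ ^ 2) := by field_simp; ring
      _ = 486 * B * e₀ ^ 2 * (h ^ 2 / Λ ^ 2) := by rw [hΛN2]
  have etot : ((4 * g₂ + 2 * g₁) * Y ^ 2 + 9 / 2 * g₁ * K₂ * e₀ + 216 * g₁ * B * Y * e₀ + 486 * B * e₀ ^ 2) * h ^ 2 / Λ ^ 2 =
      (4 * g₂ + 2 * g₁) * Y ^ 2 * (h ^ 2 / Λ ^ 2) + 9 / 2 * g₁ * K₂ * e₀ * (h ^ 2 / Λ ^ 2) + 216 * g₁ * B * Y * e₀ * (h ^ 2 / Λ ^ 2) +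
        486 * B * e₀ ^ 2 * (h ^ 2 / Λ ^ 2) := by ring
  rw [etot, mul_one]
  linarith [t1, t2, t3, t4]

/-! ### §3 The angular width factor, the moment constant and the bracket -/

/-- `1 + 6/w_n ≤ 3·2ⁿ` (`w_n = π/2ⁿ`, `6/π ≤ 2`). [folklore] -/
theorem one_add_six_div_sectorWidth_le (n : ℕ) : 1 + 6 * (sectorWidth n)⁻¹ ≤ 3 * (2 : ℝ) ^ n ∧ 0 ≤ 1 + 6 * (sectorWidth n)⁻¹ := by
  have hπ := Real.pi_gt_three
  have hN1 : (1 : ℝ) ≤ (2 : ℝ) ^ n := one_le_pow₀ (by norm_num)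
  have hw : 0 < sectorWidth n := sectorWidth_pos n
  refine ⟨?_, by positivity⟩
  rw [sectorWidth, inv_div]
  have h1 : 6 * ((2 : ℝ) ^ n / π) ≤ 2 * (2 : ℝ) ^ n := by
    rw [mul_div_assoc', div_le_iff₀ Real.pi_pos]
    nlinarith
  linarith

/-- **The moment-constant ratio**: with `s₁ = 2Λ/(π√K)`, `s₂ = 4Λ/(LU√K)`, `V ≥ N/2` and `LU ≤ 3πN`: `2√2·s₁/(s₂V) ≤ 6√2`. [folklore] -/
theorem cw_ratio_le {K Λ L U V N : ℝ} (hK : 0 < Real.sqrt K) (hΛ : 0 < Λ) (hL : 0 < L) (hU : 0 < U) (hN : 0 < N) (hV : N / 2 ≤ V)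
    (hLU : L * U ≤ 3 * π * N) :
    2 * Real.sqrt 2 * (2 * Λ / (π * Real.sqrt K)) / (4 * Λ / (L * U * Real.sqrt K) * V) ≤ 6 * Real.sqrt 2 := by
  have hπ := Real.pi_pos
  have hV0 : 0 < V := lt_of_lt_of_le (by positivity) hV
  have e : 2 * Real.sqrt 2 * (2 * Λ / (π * Real.sqrt K)) / (4 * Λ / (L * U * Real.sqrt K) * V) = Real.sqrt 2 * ((L * U) / (π * V)) := by
    field_simp
    ring
  rw [e]
  have h1 : (L * U) / (π * V) ≤ 6 := by
    rw [div_le_iff₀ (by positivity)]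
    nlinarith
  have h2 : 0 ≤ Real.sqrt 2 := Real.sqrt_nonneg 2
  nlinarith

/-- **The bracket of the weighted master lemma against p4's bracket**: for `0 ≤ C ≤ C₀` and `n₂, n₃, fr ≥ 0`,
`C²·(n₂n₃) + fr/16 ≤ (C₀²/4 + 1/16)·(4(n₂n₃) + fr)`. [folklore] -/
theorem bracketWt_le {C C₀ n2 n3 fr : ℝ} (hC0 : 0 ≤ C) (hC : C ≤ C₀) (hn2 : 0 ≤ n2) (hn3 : 0 ≤ n3) (hfr : 0 ≤ fr) :
    C ^ 2 * (n2 * n3) + fr / 16 ≤ (C₀ ^ 2 / 4 + 1 / 16) * (4 * (n2 * n3) + fr) := by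
  have hsq : C ^ 2 ≤ C₀ ^ 2 := pow_le_pow_left₀ hC0 hC 2
  have hnn : 0 ≤ n2 * n3 := mul_nonneg hn2 hn3
  nlinarith [mul_le_mul_of_nonneg_right hsq hnn, sq_nonneg C₀]

end Summit.HubbardSuperconductivity.HubbardSuperconductivity.Theorems.TorusFourierL2

end
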